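import Summits.QuantumFields.BalabanUV.Beta.FP.DirectionalJetShapes
import Summits.QuantumFields.BalabanUV.Beta.FP.GradedPackedHess

/-!
# `BalabanUV.Beta.FP.LevelZeroDoorShapes` — road «FP» for binder row D1, ROUTE T, memo `N2B-DESIGN.md` (31d)∕(32e)∕(33e) STEP 1 **CONCRETE**, FILE 1∕2:
# THE PER-JET LINEARITY LEMMAS OF THE LEVEL-0 DOOR's SHAPES (table families on `V = (β → ℝ) × (γ → ℝ)`, block currency, the DRESSED WORDS as functions
# of the direction) — consumed by FILE 2∕2 `FP/LevelZeroDoorSocket` («THE LEVEL-0 DOOR AS ONE HYPOTHESIS»)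

WHY.  #33 `DirectionalDoorKernelLaw.mixedVar_kernel_law_of_directional_door` (STEP 1 of the level-0 assembly, abstract form) asks ONE linearity hypothesis
per jet slot.  FILE 2∕2 `FP/LevelZeroDoorSocket` discharges them for the CONCRETE jet shapes of the level-0 door (U21 ∕ U23♭); THIS FILE holds the
[folklore] bricks it needs, stated once in generic index types: §1 the table-family shapes on the product direction space `V = (β → ℝ) × (γ → ℝ)` (bond
weight `v.1`, gauge parameter `v.2`; the GAUGE-SHIFTED weight `v.1 b + Σ_s D b s · v.2 s` of U21's `hH′₁ hH′₂ h𝔔′₁`; #33 §4 ∕ #34 read at `V`), §2 the block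
currency (`fromRows · 0`, `toBlocks₁₁` additive and homogeneous in the one-hypothesis form), §2b `hessT_law_of_mixedVar_law` (#24's leg-currency step
as a socket on ONE bond pair: a `mixedVar` identity at graded jets + right inverses of the three base matrices ⟹ the `hessT` identity on the packed legs —
`GradedPackedHess.mixedVar_signTwist_fromRows_zero_of_mul_eq_one` ×3), §3 the DRESSED WORDS of #32 as functions of the direction:
`orderOne_word_lin` (the order-1 word along linear first jets is linear), `word_add_form` (a free element `K` added INSIDE the order-2 word's `H₂` slot comes
out as `+ L·K·I` — how the U-file's `G`-inside-`H₂` statement meets #33's `G₂ v v + Φ_G E`), `orderTwo_word_lin_left ∕ _right` (the POLARISED order-2 word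
`W₂♭(X(v) | X(v′) | H₂(v,v′), B_q(v,v′))` along linear first jets and bilinear second jets is bilinear — #32 `orderTwo_word_split` + `orderTwo_bil_*` +
`orderTwo_lin_*`, the word emitted from ONE textual template as in #32).  [folklore] finite (bi)linear algebra; no `def`, no `def … : Prop`, nothing cited,
0 sorry.

HONEST DEPENDENCY (page 1, mandatory): continuum YM on T⁴ ⇐ BetaPertH ∧ nine spine estimates (0/9 proved); BetaPertH ⇐ (D1) ∧ (D4) ∧ CAP+tail;
G-an2-4 gates asym, D1 and NE2/3/4.  HONEST FRAMING (cell contract, verbatim): «discharging `BetaPertH` makes Bałaban's UV stability UNCONDITIONAL —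
a real constructive-QFT result; it is NOT the continuum limit and NOT the Clay problem.»  ABSOLUTE RULE (cell charter, verbatim): «No internally-minted
statement may enter as a cited fact. Every hypothesis is either kernel-proved in this package or a verbatim quotation of a PUBLISHED theorem with page
reference. The manuscript(s) under audit are NOT citable for their own disputed steps — they are the thing under adjudication; programme-internal
(2001/route/tribunal) claims are never citable.»  Nothing of Bałaban's ∕ the dictionary's asserted; 0 estimates; 0∕4 row-D1 binders (hW, hR, D1Tel, D1Rep);
NOT (T-ID), NOT SDF, NOT D1, NOT BetaPertH, NOT continuum, NOT Clay.  Road «FP» OWNER, b2b-balaban-beta-d1-p3 gen 25, 2026-08-23.  No existing file touched.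
-/

noncomputable section

open scoped BigOperators Matrix

namespace Summit.QuantumFields.BalabanUV.Beta.FP.LevelZeroDoorShapes

open Matrix
open Literature.MathematicalPhysics.QuantumFieldTheory.Balaban1983to89.Beta.Composition (kkt)
open Summit.QuantumFields.BalabanUV.Beta.D1BFx.MixedVarPackedHess (hessT)
open Summit.QuantumFields.BalabanUV.Beta.FP.SecondVarPolarisation (mixedVar)
open Summit.QuantumFields.BalabanUV.Beta.FP.GradedPackedHess (mixedVar_signTwist_fromRows_zero_of_mul_eq_one)
open Summit.QuantumFields.BalabanUV.Beta.FP.DressedWordsPacked (orderOne_word_add orderOne_word_smul orderTwo_word_split orderTwo_bil_add_left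
  orderTwo_bil_smul_left orderTwo_bil_add_right orderTwo_bil_smul_right orderTwo_lin_add orderTwo_lin_smul)
open Summit.QuantumFields.BalabanUV.Beta.FP.DirectionalDoorKernelLaw (lin_sum_smul bilin_sum_sum_smul_left bilin_sum_sum_smul_right)
open Summit.QuantumFields.BalabanUV.Beta.FP.DirectionalJetShapes (lin_shift lin_diagonal_fun)

/-! ## §1 The direction space `V = (β → ℝ) × (γ → ℝ)` and the table-family jet shapes -/

section Shapes

variable {β γ M : Type*} [AddCommGroup M] [Module ℝ M]

/-- [folklore] **A TABLE FAMILY WEIGHTED BY THE BOND COMPONENT IS LINEAR** (U21's `hH₁ hQ₁₁ hQ₂₁` shapes read on `V`; `(c • x + y).1 = c • x.1 + y.1` is `rfl`). -/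
theorem lin_sum_fst_smul [Fintype β] (T : β → M) (c : ℝ) (x y : (β → ℝ) × (γ → ℝ)) :
    (∑ b, (c • x + y).1 b • T b) = c • (∑ b, x.1 b • T b) + ∑ b, y.1 b • T b :=
  lin_sum_smul T c x.1 y.1

/-- [folklore] the gauge-shifted weight `h_b + Σ_s D b s · λ_s` is entrywise linear in `(h, λ)` (#34 `lin_shift`, read at one bond). -/
theorem shift_apply_lin [Fintype γ] (D : β → γ → ℝ) (c : ℝ) (x y : (β → ℝ) × (γ → ℝ)) (b : β) :
    (c • x + y).1 b + ∑ s, D b s * (c • x + y).2 s = c * (x.1 b + ∑ s, D b s * x.2 s) + (y.1 b + ∑ s, D b s * y.2 s) := by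
  have h := congrFun (lin_shift D c x y) b
  simpa only [Pi.add_apply, Pi.smul_apply, smul_eq_mul] using h

/-- [folklore] **A TABLE FAMILY WEIGHTED BY THE GAUGE-SHIFTED WEIGHT IS LINEAR** (U21's `hH′₁` shape). -/
theorem lin_sum_shift_smul [Fintype β] [Fintype γ] (T : β → M) (D : β → γ → ℝ) (c : ℝ) (x y : (β → ℝ) × (γ → ℝ)) :
    (∑ b, ((c • x + y).1 b + ∑ s, D b s * (c • x + y).2 s) • T b)
      = c • (∑ b, (x.1 b + ∑ s, D b s * x.2 s) • T b) + ∑ b, (y.1 b + ∑ s, D b s * y.2 s) • T b := by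
  have e : ∀ b, ((c • x + y).1 b + ∑ s, D b s * (c • x + y).2 s) • T b
      = c • ((x.1 b + ∑ s, D b s * x.2 s) • T b) + (y.1 b + ∑ s, D b s * y.2 s) • T b := fun b => by
    rw [shift_apply_lin, add_smul, mul_smul]
  simp only [e, Finset.sum_add_distrib, Finset.smul_sum]

/-- [folklore] **A BI-TABLE FAMILY ALONG THE BOND COMPONENTS IS LINEAR ON THE LEFT** (U21's `hH₂ hQ₁₂` shapes). -/
theorem bilin_sum_sum_fst_left [Fintype β] (T : β → β → M) (c : ℝ) (x y z : (β → ℝ) × (γ → ℝ)) :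
    (∑ b, ∑ b', ((c • x + y).1 b * z.1 b') • T b b') = c • (∑ b, ∑ b', (x.1 b * z.1 b') • T b b') + ∑ b, ∑ b', (y.1 b * z.1 b') • T b b' :=
  bilin_sum_sum_smul_left T c x.1 y.1 z.1

/-- [folklore] … and ON THE RIGHT. -/
theorem bilin_sum_sum_fst_right [Fintype β] (T : β → β → M) (c : ℝ) (x y z : (β → ℝ) × (γ → ℝ)) :
    (∑ b, ∑ b', (z.1 b * (c • x + y).1 b') • T b b') = c • (∑ b, ∑ b', (z.1 b * x.1 b') • T b b') + ∑ b, ∑ b', (z.1 b * y.1 b') • T b b' :=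
  bilin_sum_sum_smul_right T c z.1 x.1 y.1

/-- [folklore] **A BI-TABLE FAMILY ALONG THE GAUGE-SHIFTED WEIGHTS IS LINEAR ON THE LEFT** (U21's `hH′₂` bi-member, polarised). -/
theorem bilin_sum_sum_shift_left [Fintype β] [Fintype γ] (T : β → β → M) (D : β → γ → ℝ) (c : ℝ) (x y z : (β → ℝ) × (γ → ℝ)) :
    (∑ b, ∑ b', (((c • x + y).1 b + ∑ s, D b s * (c • x + y).2 s) * (z.1 b' + ∑ s, D b' s * z.2 s)) • T b b')
      = c • (∑ b, ∑ b', ((x.1 b + ∑ s, D b s * x.2 s) * (z.1 b' + ∑ s, D b' s * z.2 s)) • T b b')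
        + ∑ b, ∑ b', ((y.1 b + ∑ s, D b s * y.2 s) * (z.1 b' + ∑ s, D b' s * z.2 s)) • T b b' := by
  have e : ∀ b b', (((c • x + y).1 b + ∑ s, D b s * (c • x + y).2 s) * (z.1 b' + ∑ s, D b' s * z.2 s)) • T b b'
      = c • (((x.1 b + ∑ s, D b s * x.2 s) * (z.1 b' + ∑ s, D b' s * z.2 s)) • T b b')
        + ((y.1 b + ∑ s, D b s * y.2 s) * (z.1 b' + ∑ s, D b' s * z.2 s)) • T b b' := fun b b' => by
    rw [shift_apply_lin, add_mul, add_smul, mul_assoc, mul_smul]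
  simp only [e, Finset.sum_add_distrib, Finset.smul_sum]

/-- [folklore] … and ON THE RIGHT. -/
theorem bilin_sum_sum_shift_right [Fintype β] [Fintype γ] (T : β → β → M) (D : β → γ → ℝ) (c : ℝ) (x y z : (β → ℝ) × (γ → ℝ)) :
    (∑ b, ∑ b', ((z.1 b + ∑ s, D b s * z.2 s) * ((c • x + y).1 b' + ∑ s, D b' s * (c • x + y).2 s)) • T b b')
      = c • (∑ b, ∑ b', ((z.1 b + ∑ s, D b s * z.2 s) * (x.1 b' + ∑ s, D b' s * x.2 s)) • T b b')
        + ∑ b, ∑ b', ((z.1 b + ∑ s, D b s * z.2 s) * (y.1 b' + ∑ s, D b' s * y.2 s)) • T b b' := by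
  have e : ∀ b b', ((z.1 b + ∑ s, D b s * z.2 s) * ((c • x + y).1 b' + ∑ s, D b' s * (c • x + y).2 s)) • T b b'
      = c • (((z.1 b + ∑ s, D b s * z.2 s) * (x.1 b' + ∑ s, D b' s * x.2 s)) • T b b')
        + ((z.1 b + ∑ s, D b s * z.2 s) * (y.1 b' + ∑ s, D b' s * y.2 s)) • T b b' := fun b b' => by
    rw [shift_apply_lin, mul_add, add_smul, mul_left_comm, mul_smul]
  simp only [e, Finset.sum_add_distrib, Finset.smul_sum]

/-- [folklore] **THE GAUGE-PARAMETER GENERATOR `E_λ = diagonal (λ ∘ pr)` IS LINEAR** (U21's `Matrix.diagonal (fun b => lam b.1)`). -/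
theorem lin_diagonal_snd [DecidableEq β] (pr : β → γ) (c : ℝ) (x y : (β → ℝ) × (γ → ℝ)) :
    Matrix.diagonal (fun b => (c • x + y).2 (pr b)) = c • Matrix.diagonal (fun b => x.2 (pr b)) + Matrix.diagonal (fun b => y.2 (pr b)) :=
  lin_diagonal_fun (fun (v : (β → ℝ) × (γ → ℝ)) (b : β) => v.2 (pr b)) (fun _ _ _ => rfl) c x y

end Shapes

/-! ## §2 Block currency: `fromRows · 0` and `toBlocks₁₁` are additive and homogeneous -/

section Blocks

variable {ν μ ρ : Type*}

/-- [folklore] `[c•A + A′; 0] = c•[A;0] + [A′;0]`. -/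
theorem fromRows_zero_lin (c : ℝ) (A A' : Matrix μ ν ℝ) :
    fromRows (c • A + A') (0 : Matrix ρ ν ℝ) = c • fromRows A (0 : Matrix ρ ν ℝ) + fromRows A' (0 : Matrix ρ ν ℝ) := by
  ext i j
  rcases i with i | i <;> simp [Matrix.fromRows]

/-- [folklore] `(X + Y)₁₁ = X₁₁ + Y₁₁`. -/
theorem toBlocks₁₁_add' (X Y : Matrix (μ ⊕ ρ) (μ ⊕ ρ) ℝ) : (X + Y).toBlocks₁₁ = X.toBlocks₁₁ + Y.toBlocks₁₁ := by
  ext a a'; rfl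

/-- [folklore] `(c • X)₁₁ = c • X₁₁`. -/
theorem toBlocks₁₁_smul' (c : ℝ) (X : Matrix (μ ⊕ ρ) (μ ⊕ ρ) ℝ) : (c • X).toBlocks₁₁ = c • X.toBlocks₁₁ := by
  ext a a'; rfl

/-- [folklore] `(c • X + Y)₁₁ = c • X₁₁ + Y₁₁` — `toBlocks₁₁` in the one-hypothesis linearity currency. -/
theorem toBlocks₁₁_lin (c : ℝ) (X Y : Matrix (μ ⊕ ρ) (μ ⊕ ρ) ℝ) : (c • X + Y).toBlocks₁₁ = c • X.toBlocks₁₁ + Y.toBlocks₁₁ := by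
  rw [toBlocks₁₁_add', toBlocks₁₁_smul']

end Blocks

/-! ## §2b Leg currency: a three-kernel `mixedVar` identity at graded jets is a `hessT` identity on the packed legs (#24's step, socket form) -/

section Legs

variable {ν₁ κ₁ ρ₁ ν₂ κ₂ ρ₂ ν₃ κ₃ ρ₃ : Type*}
  [Fintype ν₁] [Fintype κ₁] [Fintype ρ₁] [DecidableEq ν₁] [DecidableEq κ₁] [DecidableEq ρ₁]
  [Fintype ν₂] [Fintype κ₂] [Fintype ρ₂] [DecidableEq ν₂] [DecidableEq κ₂] [DecidableEq ρ₂]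
  [Fintype ν₃] [Fintype κ₃] [Fintype ρ₃] [DecidableEq ν₃] [DecidableEq κ₃] [DecidableEq ρ₃]

/-- [folklore] **STEP 2 AS A SOCKET** (#24 `KernelDoorLegCurrency`'s step, stated on ONE bond pair): a `mixedVar` identity of three graded zero-slice systems at
graded jets (the conclusion of #33 ∕ of FILE 2∕2's `mixedVar_kernel_law_of_levelZero_door` at a pair `(k,l)`) plus RIGHT INVERSES of the three base matrices
IS the `hessT` identity of the packed legs against the packed graded vertices (`GradedPackedHess.mixedVar_signTwist_fromRows_zero_of_mul_eq_one` ×3). -/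
theorem hessT_law_of_mixedVar_law
    {N₀ XN : Matrix (ν₁ ⊕ (κ₁ ⊕ ρ₁)) (ν₁ ⊕ (κ₁ ⊕ ρ₁)) ℝ} {F₀ XF : Matrix (ν₂ ⊕ (κ₂ ⊕ ρ₂)) (ν₂ ⊕ (κ₂ ⊕ ρ₂)) ℝ}
    {G₀ XG : Matrix (ν₃ ⊕ (κ₃ ⊕ ρ₃)) (ν₃ ⊕ (κ₃ ⊕ ρ₃)) ℝ}
    (Nₛ Nₜ Nₛₜ : Matrix ν₁ ν₁ ℝ) (Mₛ Mₜ Mₛₜ : Matrix κ₁ ν₁ ℝ) (Fₛ Fₜ Fₛₜ : Matrix ν₂ ν₂ ℝ) (Eₛ Eₜ Eₛₜ : Matrix κ₂ ν₂ ℝ)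
    (Gₛ Gₜ Gₛₜ : Matrix ν₃ ν₃ ℝ) (Rₛ Rₜ Rₛₜ : Matrix κ₃ ν₃ ℝ)
    (h : mixedVar N₀ (fromBlocks Nₛ (-(fromRows Mₛ (0 : Matrix ρ₁ ν₁ ℝ))ᵀ) (fromRows Mₛ (0 : Matrix ρ₁ ν₁ ℝ)) 0)
          (fromBlocks Nₜ (-(fromRows Mₜ (0 : Matrix ρ₁ ν₁ ℝ))ᵀ) (fromRows Mₜ (0 : Matrix ρ₁ ν₁ ℝ)) 0) (kkt Nₛₜ (fromRows Mₛₜ (0 : Matrix ρ₁ ν₁ ℝ)))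
        = mixedVar F₀ (fromBlocks Fₛ (-(fromRows Eₛ (0 : Matrix ρ₂ ν₂ ℝ))ᵀ) (fromRows Eₛ (0 : Matrix ρ₂ ν₂ ℝ)) 0)
            (fromBlocks Fₜ (-(fromRows Eₜ (0 : Matrix ρ₂ ν₂ ℝ))ᵀ) (fromRows Eₜ (0 : Matrix ρ₂ ν₂ ℝ)) 0) (kkt Fₛₜ (fromRows Eₛₜ (0 : Matrix ρ₂ ν₂ ℝ)))
          + mixedVar G₀ (fromBlocks Gₛ (-(fromRows Rₛ (0 : Matrix ρ₃ ν₃ ℝ))ᵀ) (fromRows Rₛ (0 : Matrix ρ₃ ν₃ ℝ)) 0)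
            (fromBlocks Gₜ (-(fromRows Rₜ (0 : Matrix ρ₃ ν₃ ℝ))ᵀ) (fromRows Rₜ (0 : Matrix ρ₃ ν₃ ℝ)) 0) (kkt Gₛₜ (fromRows Rₛₜ (0 : Matrix ρ₃ ν₃ ℝ))))
    (hXN : N₀ * XN = 1) (hXF : F₀ * XF = 1) (hXG : G₀ * XG = 1) :
    hessT (XN.submatrix (Sum.map id Sum.inl) (Sum.map id Sum.inl)) (fromBlocks Nₛ (-Mₛᵀ) Mₛ 0) (fromBlocks Nₜ (-Mₜᵀ) Mₜ 0) (kkt Nₛₜ Mₛₜ)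
      = hessT (XF.submatrix (Sum.map id Sum.inl) (Sum.map id Sum.inl)) (fromBlocks Fₛ (-Eₛᵀ) Eₛ 0) (fromBlocks Fₜ (-Eₜᵀ) Eₜ 0) (kkt Fₛₜ Eₛₜ)
        + hessT (XG.submatrix (Sum.map id Sum.inl) (Sum.map id Sum.inl)) (fromBlocks Gₛ (-Rₛᵀ) Rₛ 0) (fromBlocks Gₜ (-Rₜᵀ) Rₜ 0) (kkt Gₛₜ Rₛₜ) := by
  rw [mixedVar_signTwist_fromRows_zero_of_mul_eq_one hXN, mixedVar_signTwist_fromRows_zero_of_mul_eq_one hXF,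
    mixedVar_signTwist_fromRows_zero_of_mul_eq_one hXG] at h
  linarith

end Legs

/-! ## §3 The dressed words as functions of the direction -/

section Words

variable {V ν π : Type*} [AddCommGroup V] [Module ℝ V] [Fintype ν] [Fintype π]
variable (Γ : Matrix ν ν ℝ) (I : Matrix ν π ℝ) (L : Matrix π ν ℝ) (S : Matrix π π ℝ)

/-- [folklore] **THE ORDER-1 DRESSED WORD ALONG LINEAR JETS IS LINEAR IN THE DIRECTION** (#32 `orderOne_word_add ∕ _smul`). -/
theorem orderOne_word_lin (H₁ : V → Matrix ν ν ℝ) (B : V → Matrix π ν ℝ)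
    (hH₁ : ∀ (c : ℝ) (x y : V), H₁ (c • x + y) = c • H₁ x + H₁ y) (hB : ∀ (c : ℝ) (x y : V), B (c • x + y) = c • B x + B y)
    (c : ℝ) (x y : V) :
    ((L * (H₁ (c • x + y)) - S * (B (c • x + y))) * I + L * (B (c • x + y))ᵀ * S)
      = c • ((L * (H₁ x) - S * (B x)) * I + L * (B x)ᵀ * S) + ((L * (H₁ y) - S * (B y)) * I + L * (B y)ᵀ * S) := by
  rw [hH₁, hB, orderOne_word_add I L S, orderOne_word_smul I L S]

/-- [folklore] **THE FREE FINE ELEMENT INSIDE THE FORM SLOT COMES OUT AS `L·K·I`**: the order-2 word at `(H₂ + K, B_q)` is the word at `(H₂, B_q)` plus `L·K·I`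
(how the U-file states the G-side order-2 slot — `G` inside `H₂` — versus #33's `G₂ v v + Φ_G E`). -/
theorem word_add_form (H₁ H₁' H₂ K : Matrix ν ν ℝ) (B B' Bq : Matrix π ν ℝ) :
    (((-((L * H₁ - S * B) * Γ - L * Bᵀ * L) * H₁' + L * (H₂ + K)
          - (((L * H₁ - S * B) * I + L * Bᵀ * S) * B' + S * Bq)) * I
        + (L * H₁ - S * B) * (-((Γ * H₁' + I * B') * I + Γ * B'ᵀ * S)))
      - ((-((L * H₁ - S * B) * Γ - L * Bᵀ * L) * (-B'ᵀ) + L * Bqᵀ) * S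
          + L * (-Bᵀ) * ((L * H₁' - S * B') * I + L * B'ᵀ * S)))
      = (((-((L * H₁ - S * B) * Γ - L * Bᵀ * L) * H₁' + L * H₂
          - (((L * H₁ - S * B) * I + L * Bᵀ * S) * B' + S * Bq)) * I
        + (L * H₁ - S * B) * (-((Γ * H₁' + I * B') * I + Γ * B'ᵀ * S)))
      - ((-((L * H₁ - S * B) * Γ - L * Bᵀ * L) * (-B'ᵀ) + L * Bqᵀ) * S
          + L * (-Bᵀ) * ((L * H₁' - S * B') * I + L * B'ᵀ * S)))
        + L * K * I := by
  simp only [Matrix.mul_add, Matrix.add_mul, Matrix.sub_mul]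
  abel

/-- [folklore] **THE POLARISED ORDER-2 DRESSED WORD `W₂♭(X(v) | X(v′) | H₂(v,v′), B_q(v,v′))` IS LINEAR IN THE LEFT DIRECTION** for linear first jets
`H₁ B` and bilinear second jets `H₂ B_q` (#32 `orderTwo_word_split` + `orderTwo_bil_add∕smul_left` + `orderTwo_lin_add∕smul`). -/
theorem orderTwo_word_lin_left (H₁ : V → Matrix ν ν ℝ) (B : V → Matrix π ν ℝ) (H₂ : V → V → Matrix ν ν ℝ) (Bq : V → V → Matrix π ν ℝ)
    (hH₁ : ∀ (c : ℝ) (x y : V), H₁ (c • x + y) = c • H₁ x + H₁ y) (hB : ∀ (c : ℝ) (x y : V), B (c • x + y) = c • B x + B y)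
    (hH₂ : ∀ (c : ℝ) (x y z : V), H₂ (c • x + y) z = c • H₂ x z + H₂ y z) (hBq : ∀ (c : ℝ) (x y z : V), Bq (c • x + y) z = c • Bq x z + Bq y z)
    (c : ℝ) (x y z : V) :
    (((-((L * (H₁ (c • x + y)) - S * (B (c • x + y))) * Γ - L * (B (c • x + y))ᵀ * L) * (H₁ z) + L * (H₂ (c • x + y) z)
          - (((L * (H₁ (c • x + y)) - S * (B (c • x + y))) * I + L * (B (c • x + y))ᵀ * S) * (B z) + S * (Bq (c • x + y) z))) * I
        + (L * (H₁ (c • x + y)) - S * (B (c • x + y))) * (-((Γ * (H₁ z) + I * (B z)) * I + Γ * (B z)ᵀ * S)))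
      - ((-((L * (H₁ (c • x + y)) - S * (B (c • x + y))) * Γ - L * (B (c • x + y))ᵀ * L) * (-(B z)ᵀ) + L * (Bq (c • x + y) z)ᵀ) * S
          + L * (-(B (c • x + y))ᵀ) * ((L * (H₁ z) - S * (B z)) * I + L * (B z)ᵀ * S)))
      = c • (((-((L * (H₁ x) - S * (B x)) * Γ - L * (B x)ᵀ * L) * (H₁ z) + L * (H₂ x z)
          - (((L * (H₁ x) - S * (B x)) * I + L * (B x)ᵀ * S) * (B z) + S * (Bq x z))) * I
        + (L * (H₁ x) - S * (B x)) * (-((Γ * (H₁ z) + I * (B z)) * I + Γ * (B z)ᵀ * S)))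
      - ((-((L * (H₁ x) - S * (B x)) * Γ - L * (B x)ᵀ * L) * (-(B z)ᵀ) + L * (Bq x z)ᵀ) * S
          + L * (-(B x)ᵀ) * ((L * (H₁ z) - S * (B z)) * I + L * (B z)ᵀ * S)))
        + (((-((L * (H₁ y) - S * (B y)) * Γ - L * (B y)ᵀ * L) * (H₁ z) + L * (H₂ y z)
          - (((L * (H₁ y) - S * (B y)) * I + L * (B y)ᵀ * S) * (B z) + S * (Bq y z))) * I
        + (L * (H₁ y) - S * (B y)) * (-((Γ * (H₁ z) + I * (B z)) * I + Γ * (B z)ᵀ * S)))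
      - ((-((L * (H₁ y) - S * (B y)) * Γ - L * (B y)ᵀ * L) * (-(B z)ᵀ) + L * (Bq y z)ᵀ) * S
          + L * (-(B y)ᵀ) * ((L * (H₁ z) - S * (B z)) * I + L * (B z)ᵀ * S))) := by
  rw [orderTwo_word_split Γ I L S (H₁ (c • x + y)) (H₁ z) (H₂ (c • x + y) z) (B (c • x + y)) (B z) (Bq (c • x + y) z),
    orderTwo_word_split Γ I L S (H₁ x) (H₁ z) (H₂ x z) (B x) (B z) (Bq x z),
    orderTwo_word_split Γ I L S (H₁ y) (H₁ z) (H₂ y z) (B y) (B z) (Bq y z),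
    hH₁, hB, hH₂, hBq, orderTwo_bil_add_left Γ I L S, orderTwo_bil_smul_left Γ I L S, orderTwo_lin_add I L S, orderTwo_lin_smul I L S, smul_add]
  abel

/-- [folklore] … and IN THE RIGHT DIRECTION (#32 `orderTwo_bil_add∕smul_right`). -/
theorem orderTwo_word_lin_right (H₁ : V → Matrix ν ν ℝ) (B : V → Matrix π ν ℝ) (H₂ : V → V → Matrix ν ν ℝ) (Bq : V → V → Matrix π ν ℝ)
    (hH₁ : ∀ (c : ℝ) (x y : V), H₁ (c • x + y) = c • H₁ x + H₁ y) (hB : ∀ (c : ℝ) (x y : V), B (c • x + y) = c • B x + B y)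
    (hH₂ : ∀ (c : ℝ) (x y z : V), H₂ z (c • x + y) = c • H₂ z x + H₂ z y) (hBq : ∀ (c : ℝ) (x y z : V), Bq z (c • x + y) = c • Bq z x + Bq z y)
    (c : ℝ) (x y z : V) :
    (((-((L * (H₁ z) - S * (B z)) * Γ - L * (B z)ᵀ * L) * (H₁ (c • x + y)) + L * (H₂ z (c • x + y))
          - (((L * (H₁ z) - S * (B z)) * I + L * (B z)ᵀ * S) * (B (c • x + y)) + S * (Bq z (c • x + y)))) * I
        + (L * (H₁ z) - S * (B z)) * (-((Γ * (H₁ (c • x + y)) + I * (B (c • x + y))) * I + Γ * (B (c • x + y))ᵀ * S)))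
      - ((-((L * (H₁ z) - S * (B z)) * Γ - L * (B z)ᵀ * L) * (-(B (c • x + y))ᵀ) + L * (Bq z (c • x + y))ᵀ) * S
          + L * (-(B z)ᵀ) * ((L * (H₁ (c • x + y)) - S * (B (c • x + y))) * I + L * (B (c • x + y))ᵀ * S)))
      = c • (((-((L * (H₁ z) - S * (B z)) * Γ - L * (B z)ᵀ * L) * (H₁ x) + L * (H₂ z x)
          - (((L * (H₁ z) - S * (B z)) * I + L * (B z)ᵀ * S) * (B x) + S * (Bq z x))) * I
        + (L * (H₁ z) - S * (B z)) * (-((Γ * (H₁ x) + I * (B x)) * I + Γ * (B x)ᵀ * S)))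
      - ((-((L * (H₁ z) - S * (B z)) * Γ - L * (B z)ᵀ * L) * (-(B x)ᵀ) + L * (Bq z x)ᵀ) * S
          + L * (-(B z)ᵀ) * ((L * (H₁ x) - S * (B x)) * I + L * (B x)ᵀ * S)))
        + (((-((L * (H₁ z) - S * (B z)) * Γ - L * (B z)ᵀ * L) * (H₁ y) + L * (H₂ z y)
          - (((L * (H₁ z) - S * (B z)) * I + L * (B z)ᵀ * S) * (B y) + S * (Bq z y))) * I
        + (L * (H₁ z) - S * (B z)) * (-((Γ * (H₁ y) + I * (B y)) * I + Γ * (B y)ᵀ * S)))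
      - ((-((L * (H₁ z) - S * (B z)) * Γ - L * (B z)ᵀ * L) * (-(B y)ᵀ) + L * (Bq z y)ᵀ) * S
          + L * (-(B z)ᵀ) * ((L * (H₁ y) - S * (B y)) * I + L * (B y)ᵀ * S))) := by
  rw [orderTwo_word_split Γ I L S (H₁ z) (H₁ (c • x + y)) (H₂ z (c • x + y)) (B z) (B (c • x + y)) (Bq z (c • x + y)),
    orderTwo_word_split Γ I L S (H₁ z) (H₁ x) (H₂ z x) (B z) (B x) (Bq z x),
    orderTwo_word_split Γ I L S (H₁ z) (H₁ y) (H₂ z y) (B z) (B y) (Bq z y),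
    hH₁, hB, hH₂, hBq, orderTwo_bil_add_right Γ I L S, orderTwo_bil_smul_right Γ I L S, orderTwo_lin_add I L S, orderTwo_lin_smul I L S, smul_add]
  abel

end Words

end Summit.QuantumFields.BalabanUV.Beta.FP.LevelZeroDoorShapes

end
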